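import Summits.AtomisticToContinuum.BoseEinsteinCondensation.Theses.BECStoquasticCensoring

/-!
# Route `BECStoquasticCensoring`, item `Assembly` (stmt-AtomisticToContinuum-14712)

`Assembly := VillainCurrentLRO → CellCountTailsU → CountViolationGapU → CellCondensationGrowing →
CensoredTransfer → _root_.BoseEinsteinCondensation`.

The hypotheses of `Assembly` are, verbatim and in the same order, those of the route's deciding
theorem `closes`, so the assembly is that theorem curried. The composition, spelled out: the transfer
bet `CensoredTransfer : VillainCurrentLRO → CellCountTailsU → CountViolationGapU →
CellCondensationGrowing → ZeroModeOccupation`, fed with the Villain engine, the two `K`-uniform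
censoring inputs and mesoscale local condensation, is the target `ZeroModeOccupation` (X_B1,
stmt-AtomisticToContinuum-0686) by name, and X_B1 → `BoseEinsteinCondensation` is the proved
zero-mode criterion `AtomisticToContinuum.BECInfraredBound.bec_of_zeroMode` (occupation of the
normalised constant mode ≤ maxOccupation ≤ condensateNumber). Pure logic; no analytic content lives
here — it lives in the five hypotheses, which stay open items of the route.
-/

namespace Summit.AtomisticToContinuum.BoseEinsteinCondensation.Theorems

open Summit.AtomisticToContinuum.BoseEinsteinCondensation.Theses.BECStoquasticCensoring

/-- **`Assembly`** (item stmt-AtomisticToContinuum-14712 of route BECStoquasticCensoring, concluded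
BY NAME): `VillainCurrentLRO → CellCountTailsU → CountViolationGapU → CellCondensationGrowing →
CensoredTransfer → BoseEinsteinCondensation` — exactly the route's deciding theorem `closes`, i.e.
`bec_of_zeroMode (hR hE hT hG hC)`: the transfer bet applied to the four typed inputs is
`ZeroModeOccupation`, and the zero-mode criterion turns that into the sub-problem statement.
[folklore] -/
theorem becStoquasticCensoring_assembly_proof :
    Summit.AtomisticToContinuum.BoseEinsteinCondensation.Theses.BECStoquasticCensoring.Assembly := by
  unfold Summit.AtomisticToContinuum.BoseEinsteinCondensation.Theses.BECStoquasticCensoring.Assembly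
  intro hE hT hG hC hR
  exact closes hE hT hG hC hR

end Summit.AtomisticToContinuum.BoseEinsteinCondensation.Theorems
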